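import Literature.NumberTheory.Sieve.PolymathGEHTupleLevelPieces
import Literature.NumberTheory.Sieve.PolymathThetaSumsProofs
import HarnessLib

/-!
# The multiplicative grid of §4.5 and the truncated inner sequence (fixed `x`)

Trunk AntSieve, tooling toward the named fact `Literature.NumberTheory.Sieve.weakDHL_three_two_of_GEH`
(D. H. J. Polymath, Res. Math. Sci. 1:12 (2014) = arXiv:1407.4897, Theorem 3.2(xii)).

§4.5, p. 17: "partition `[x^ε, 2x+h_k]` by `O(log^{A+1} x)` intervals `I_1, …, I_m`, with each `I_j`
contained in an interval of the form `[N, (1 + log^{-A} x) N]`".  The concrete grid, defined for ALL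
`x` (so that the `GEH` family lemmas, which quantify over all `x`, can be fed):
`ρ = 1 + L^{-A₀}` with `L = max(log x, 2)`, `c_j = max(3, ⌊x^ε ρ^j⌋)` (`gridAt`), `J = ⌊2 log x / log ρ⌋`
(`gridJ`).  Basic facts: monotonicity, `c_{j+1} ≤ 2 c_j`, `c_{j+1} ≤ ρ (1 + 2x^{-ε}) c_j`, `c_{J+1} ≥ 3x`,
`J + 1 ≤ 4 log x · L^{A₀} + 1`; and the truncated inner sequence
`w_ε(n) = λ_F(n) λ_G(n) 1_{p(n) > x^ε}` (`wTrunc`) with its bound `|w_ε(n)| ≤ 4^{Ω(n)} M²` and the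
structure of the integers it charges (prime factors in `(c_0, c_{J+1}]`, at most `⌊1/ε⌋ + 1` of them).

## References

* [Polymath8b2014] D. H. J. Polymath, Res. Math. Sci. 1 (2014), Art. 12 = arXiv:1407.4897,
  §4.5, p. 17.
-/

noncomputable section

open Finset Real
open scoped ArithmeticFunction.omega ArithmeticFunction.Moebius

namespace Literature.NumberTheory.Sieve

open scoped Classical

/-! ### The grid -/

section GridDefs

/-- `L = max(log x, 2)`. [folklore] -/
def logFloor (x : ℝ) : ℝ := max (Real.log x) 2

/-- `ρ = 1 + L^{-A₀}`. [cite: Polymath8b2014, §4.5, p. 17] -/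
def gridRho (A₀ x : ℝ) : ℝ := 1 + logFloor x ^ (-A₀)

/-- `c_j = max(3, ⌊x^ε ρ^j⌋)`. [cite: Polymath8b2014, §4.5, p. 17] -/
def gridAt (ε A₀ x : ℝ) (j : ℕ) : ℕ := max 3 ⌊x ^ ε * gridRho A₀ x ^ j⌋₊

/-- `J = ⌊2 log x / log ρ⌋`. [cite: Polymath8b2014, §4.5, p. 17] -/
def gridJ (A₀ x : ℝ) : ℕ := ⌊2 * Real.log x / Real.log (gridRho A₀ x)⌋₊

/-- `L ≥ 2`. [folklore] -/
theorem two_le_logFloor (x : ℝ) : 2 ≤ logFloor x := le_max_right _ _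

/-- `L > 0`. [folklore] -/
theorem logFloor_pos (x : ℝ) : 0 < logFloor x := lt_of_lt_of_le (by norm_num) (two_le_logFloor x)

/-- `L = log x` once `log x ≥ 2`. [folklore] -/
theorem logFloor_eq_log {x : ℝ} (hx : 2 ≤ Real.log x) : logFloor x = Real.log x := max_eq_left hx

/-- `0 < L^{-A₀} ≤ 2^{-A₀}`. [folklore] -/
theorem logFloor_rpow_neg_le {A₀ : ℝ} (hA₀ : 0 ≤ A₀) (x : ℝ) : logFloor x ^ (-A₀) ≤ (2 : ℝ) ^ (-A₀) :=
  Real.rpow_le_rpow_of_nonpos (by norm_num) (two_le_logFloor x) (by linarith)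

/-- `ρ > 1`. [folklore] -/
theorem one_lt_gridRho (A₀ x : ℝ) : 1 < gridRho A₀ x := by
  unfold gridRho
  have := Real.rpow_pos_of_pos (logFloor_pos x) (-A₀)
  linarith

/-- `ρ > 0`. [folklore] -/
theorem gridRho_pos (A₀ x : ℝ) : 0 < gridRho A₀ x := lt_trans one_pos (one_lt_gridRho A₀ x)

/-- `ρ - 1 = L^{-A₀}`. [folklore] -/
theorem gridRho_sub_one_eq (A₀ x : ℝ) : gridRho A₀ x - 1 = logFloor x ^ (-A₀) := by
  unfold gridRho; ring

/-- `ρ - 1 = L^{-A₀} ≤ 1/4` for `A₀ ≥ 2`. [folklore] -/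
theorem gridRho_sub_one_le {A₀ : ℝ} (hA₀ : 2 ≤ A₀) (x : ℝ) : gridRho A₀ x - 1 ≤ 1 / 4 := by
  have h : logFloor x ^ (-A₀) ≤ 1 / 4 :=
    calc logFloor x ^ (-A₀) ≤ (2 : ℝ) ^ (-A₀) := logFloor_rpow_neg_le (by linarith : 0 ≤ A₀) x
      _ ≤ (2 : ℝ) ^ (-(2 : ℝ)) := Real.rpow_le_rpow_of_exponent_le (by norm_num) (by linarith)
      _ = 1 / 4 := by rw [Real.rpow_neg (by norm_num), Real.rpow_two]; norm_num
  rw [gridRho_sub_one_eq]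
  exact h

/-- `ρ ≤ 5/4` for `A₀ ≥ 2`. [folklore] -/
theorem gridRho_le {A₀ : ℝ} (hA₀ : 2 ≤ A₀) (x : ℝ) : gridRho A₀ x ≤ 5 / 4 := by
  have := gridRho_sub_one_le hA₀ x; linarith

/-- `c_j ≥ 3`. [folklore] -/
theorem three_le_gridAt (ε A₀ x : ℝ) (j : ℕ) : 3 ≤ gridAt ε A₀ x j := le_max_left _ _

/-- The grid is monotone in `j` (any real `x`: for `x^ε < 0` all `c_j = 3`). [folklore] -/
theorem gridAt_mono (ε A₀ x : ℝ) : Monotone (gridAt ε A₀ x) := by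
  intro i j hij
  unfold gridAt
  by_cases hxε : 0 ≤ x ^ ε
  · refine max_le_max le_rfl (Nat.floor_le_floor ?_)
    refine mul_le_mul_of_nonneg_left ?_ hxε
    exact pow_le_pow_right₀ (one_lt_gridRho A₀ x).le hij
  · push Not at hxε
    have h0 : ∀ k : ℕ, ⌊x ^ ε * gridRho A₀ x ^ k⌋₊ = 0 := fun k =>
      Nat.floor_of_nonpos (mul_nonpos_of_nonpos_of_nonneg hxε.le (pow_nonneg (gridRho_pos A₀ x).le k))
    rw [h0, h0]

/-- `c_{j+1} ≤ 2 c_j` (for `A₀ ≥ 2`, any real `x`). [folklore] -/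
theorem gridAt_succ_le {ε A₀ : ℝ} (hA₀ : 2 ≤ A₀) (x : ℝ) (j : ℕ) :
    gridAt ε A₀ x (j + 1) ≤ 2 * gridAt ε A₀ x j := by
  unfold gridAt
  set y : ℝ := x ^ ε * gridRho A₀ x ^ j with hy
  have hρ := gridRho_le hA₀ x
  have hnext : x ^ ε * gridRho A₀ x ^ (j + 1) = y * gridRho A₀ x := by rw [hy, pow_succ]; ring
  rw [hnext]
  refine max_le (by omega) ?_
  by_cases hy0 : 0 ≤ y
  swap
  · push Not at hy0
    rw [Nat.floor_of_nonpos (mul_nonpos_of_nonpos_of_nonneg hy0.le (gridRho_pos A₀ x).le)]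
    omega
  -- `⌊y ρ⌋ ≤ ⌊(5/4)(⌊y⌋ + 1)⌋ ≤ 2 max 3 ⌊y⌋`
  have h1 : y * gridRho A₀ x ≤ 5 / 4 * (⌊y⌋₊ + 1) := by
    have hfl : y < ⌊y⌋₊ + 1 := Nat.lt_floor_add_one y
    calc y * gridRho A₀ x ≤ y * (5 / 4) := mul_le_mul_of_nonneg_left hρ hy0
      _ ≤ (⌊y⌋₊ + 1) * (5 / 4) := mul_le_mul_of_nonneg_right hfl.le (by norm_num)
      _ = 5 / 4 * (⌊y⌋₊ + 1) := by ring
  have h2 : (⌊y * gridRho A₀ x⌋₊ : ℝ) ≤ 5 / 4 * (⌊y⌋₊ + 1) := (Nat.floor_le (mul_nonneg hy0 (gridRho_pos A₀ x).le)).trans h1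
  have h3 : (5 : ℝ) / 4 * (⌊y⌋₊ + 1) ≤ 2 * (max 3 ⌊y⌋₊ : ℕ) := by
    have hm : (max 3 ⌊y⌋₊ : ℕ) = max (3 : ℝ) (⌊y⌋₊ : ℝ) := by push_cast; rfl
    rw [hm]
    rcases le_or_gt (3 : ℝ) ⌊y⌋₊ with h | h
    · rw [max_eq_right h]; linarith
    · rw [max_eq_left h.le]; linarith
  exact_mod_cast h2.trans h3

/-- For `y ≥ 3`: `max 3 ⌊y⌋ = ⌊y⌋`, so `c_j ≤ x^ε ρ^j`. [folklore] -/
theorem gridAt_le_real {ε A₀ x : ℝ} {j : ℕ} (h3 : 3 ≤ x ^ ε * gridRho A₀ x ^ j) :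
    (gridAt ε A₀ x j : ℝ) ≤ x ^ ε * gridRho A₀ x ^ j := by
  unfold gridAt
  have hfl : 3 ≤ ⌊x ^ ε * gridRho A₀ x ^ j⌋₊ := Nat.le_floor (by exact_mod_cast h3)
  rw [max_eq_right hfl]
  exact Nat.floor_le (by linarith)

/-- `c_j > x^ε ρ^j - 1`. [folklore] -/
theorem real_lt_gridAt (ε A₀ x : ℝ) (j : ℕ) : x ^ ε * gridRho A₀ x ^ j - 1 < gridAt ε A₀ x j := by
  unfold gridAt
  have h1 : x ^ ε * gridRho A₀ x ^ j - 1 < ⌊x ^ ε * gridRho A₀ x ^ j⌋₊ := by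
    have := Nat.lt_floor_add_one (x ^ ε * gridRho A₀ x ^ j); linarith
  refine lt_of_lt_of_le h1 ?_
  exact_mod_cast le_max_right 3 ⌊x ^ ε * gridRho A₀ x ^ j⌋₊

/-- **The ratio of consecutive grid points**: `c_{j+1} ≤ ρ (1 + 2 x^{-ε}) c_j` when `x^ε ≥ 3`
("each `I_j` contained in an interval of the form `[N, (1 + log^{-A} x) N]`"). [cite: Polymath8b2014, §4.5, p. 17] -/
theorem gridAt_succ_le_ratio {ε A₀ x : ℝ} (hx : 0 < x) (h3 : 3 ≤ x ^ ε) (j : ℕ) :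
    (gridAt ε A₀ x (j + 1) : ℝ) ≤ gridRho A₀ x * (1 + 2 / x ^ ε) * gridAt ε A₀ x j := by
  have hρ1 := (one_lt_gridRho A₀ x).le
  have hρ0 := gridRho_pos A₀ x
  have hxε : 0 < x ^ ε := by positivity
  set y : ℝ := x ^ ε * gridRho A₀ x ^ j with hy
  have hyge : x ^ ε ≤ y := by
    rw [hy]; exact le_mul_of_one_le_right hxε.le (one_le_pow₀ hρ1)
  have hc : y - 1 < gridAt ε A₀ x j := real_lt_gridAt ε A₀ x j
  have hcpos : (0 : ℝ) < gridAt ε A₀ x j := by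
    have := three_le_gridAt ε A₀ x j
    exact_mod_cast (show 0 < gridAt ε A₀ x j by omega)
  have hfactor : 1 ≤ gridRho A₀ x * (1 + 2 / x ^ ε) := by
    have : (1 : ℝ) ≤ 1 + 2 / x ^ ε := by have := div_nonneg (by norm_num : (0:ℝ) ≤ 2) hxε.le; linarith
    nlinarith
  by_cases hnext : 3 ≤ x ^ ε * gridRho A₀ x ^ (j + 1)
  · calc (gridAt ε A₀ x (j + 1) : ℝ) ≤ x ^ ε * gridRho A₀ x ^ (j + 1) := gridAt_le_real hnext
      _ = gridRho A₀ x * y := by rw [hy, pow_succ]; ring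
      _ ≤ gridRho A₀ x * (gridAt ε A₀ x j + 1) := mul_le_mul_of_nonneg_left (by linarith) hρ0.le
      _ ≤ gridRho A₀ x * ((1 + 2 / x ^ ε) * gridAt ε A₀ x j) := by
          refine mul_le_mul_of_nonneg_left ?_ hρ0.le
          -- `c + 1 ≤ (1 + 2/x^ε) c` iff `x^ε ≤ 2c`, and `2c > 2(y - 1) ≥ 2x^ε - 2 ≥ x^ε`
          rw [add_mul, one_mul, add_le_add_iff_left, div_mul_eq_mul_div, le_div_iff₀ hxε]
          nlinarith
      _ = gridRho A₀ x * (1 + 2 / x ^ ε) * gridAt ε A₀ x j := by ring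
  · -- then `c_{j+1} = 3 ≤ c_j`
    push Not at hnext
    have h3' : gridAt ε A₀ x (j + 1) = 3 := by
      unfold gridAt
      rw [max_eq_left]
      exact (Nat.floor_lt (by positivity)).2 hnext |>.le |> fun h => by omega
    rw [h3']
    calc ((3 : ℕ) : ℝ) ≤ gridAt ε A₀ x j := by exact_mod_cast three_le_gridAt ε A₀ x j
      _ = 1 * gridAt ε A₀ x j := (one_mul _).symm
      _ ≤ gridRho A₀ x * (1 + 2 / x ^ ε) * gridAt ε A₀ x j := mul_le_mul_of_nonneg_right hfactor hcpos.le

/-- `c_0 = ⌊x^ε⌋` when `x^ε ≥ 3`. [folklore] -/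
theorem gridAt_zero {ε A₀ x : ℝ} (h3 : 3 ≤ x ^ ε) : gridAt ε A₀ x 0 = ⌊x ^ ε⌋₊ := by
  unfold gridAt
  rw [pow_zero, mul_one, max_eq_right]
  exact Nat.le_floor (by exact_mod_cast h3)

/-- **The top of the grid**: `c_{J+1} ≥ 3x` for `x ≥ 4`. [folklore] -/
theorem three_mul_le_gridAt_gridJ {ε A₀ x : ℝ} (hε : 0 ≤ ε) (hx : 4 ≤ x) :
    3 * x ≤ gridAt ε A₀ x (gridJ A₀ x + 1) := by
  have hx0 : 0 < x := by linarith
  have hx1 : 1 ≤ x := by linarith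
  have hρ1 := one_lt_gridRho A₀ x
  have hlogρ : 0 < Real.log (gridRho A₀ x) := Real.log_pos hρ1
  -- `ρ^{J+1} ≥ x²`
  have hJ : 2 * Real.log x / Real.log (gridRho A₀ x) < (gridJ A₀ x : ℝ) + 1 := Nat.lt_floor_add_one _
  have hpow : x ^ 2 ≤ gridRho A₀ x ^ (gridJ A₀ x + 1) := by
    have h1 : Real.log (x ^ 2) ≤ Real.log (gridRho A₀ x ^ (gridJ A₀ x + 1)) := by
      rw [Real.log_pow, Real.log_pow, Nat.cast_ofNat]
      push_cast
      have := (div_lt_iff₀ hlogρ).1 hJ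
      linarith
    exact (Real.log_le_log_iff (by positivity) (by positivity)).1 h1
  have hxε : 1 ≤ x ^ ε := Real.one_le_rpow hx1 hε
  have hy : x ^ 2 ≤ x ^ ε * gridRho A₀ x ^ (gridJ A₀ x + 1) :=
    le_trans hpow (le_mul_of_one_le_left (by positivity) hxε)
  have h3 : (3 : ℝ) ≤ x ^ ε * gridRho A₀ x ^ (gridJ A₀ x + 1) := le_trans (by nlinarith) hy
  have hc := real_lt_gridAt ε A₀ x (gridJ A₀ x + 1)
  nlinarith

/-- **The number of pieces**: `J ≤ 4 log x · L^{A₀}` (for `x ≥ 1`, `A₀ ≥ 0`). [cite: Polymath8b2014, §4.5, p. 17] -/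
theorem gridJ_le {A₀ x : ℝ} (hA₀ : 0 ≤ A₀) (hx : 1 ≤ x) :
    (gridJ A₀ x : ℝ) ≤ 4 * Real.log x * logFloor x ^ A₀ := by
  have hρ1 := one_lt_gridRho A₀ x
  have hρ0 := gridRho_pos A₀ x
  have hlog0 : 0 ≤ Real.log x := Real.log_nonneg hx
  set u : ℝ := logFloor x ^ (-A₀) with hu
  have hu0 : 0 < u := Real.rpow_pos_of_pos (logFloor_pos x) _
  have hu1 : u ≤ 1 := by
    have := logFloor_rpow_neg_le hA₀ x
    have h2 : (2 : ℝ) ^ (-A₀) ≤ 1 := Real.rpow_le_one_of_one_le_of_nonpos (by norm_num) (by linarith)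
    linarith
  have hρu : gridRho A₀ x = 1 + u := rfl
  -- `log ρ ≥ u/(1+u) ≥ u/2`
  have hlogρ : u / 2 ≤ Real.log (gridRho A₀ x) := by
    have h := Real.one_sub_inv_le_log_of_pos hρ0
    rw [hρu] at h ⊢
    have e : 1 - (1 + u)⁻¹ = u / (1 + u) := by field_simp; ring
    rw [e] at h
    have : u / 2 ≤ u / (1 + u) := div_le_div_of_nonneg_left hu0.le (by linarith) (by linarith)
    linarith
  have hlogρ0 : 0 < Real.log (gridRho A₀ x) := Real.log_pos hρ1
  have hinv : u⁻¹ = logFloor x ^ A₀ := by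
    rw [hu, Real.rpow_neg (logFloor_pos x).le, inv_inv]
  calc (gridJ A₀ x : ℝ) ≤ 2 * Real.log x / Real.log (gridRho A₀ x) := Nat.floor_le (by positivity)
    _ ≤ 2 * Real.log x / (u / 2) := div_le_div_of_nonneg_left (by positivity) (by positivity) hlogρ
    _ = 4 * Real.log x * u⁻¹ := by field_simp; ring
    _ = 4 * Real.log x * logFloor x ^ A₀ := by rw [hinv]

end GridDefs

/-! ### Sizes of the window `(X₁, X₂]` -/

/-- For `x ≥ |h₀| + 2`: `1 ≤ X₁ ≤ X₂ ≤ 3x`. [folklore] -/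
theorem thetaX_sizes (h₀ : ℤ) {x : ℝ} (hx : (h₀.natAbs : ℝ) + 2 ≤ x) :
    1 ≤ thetaX1 h₀ x ∧ thetaX1 h₀ x ≤ thetaX2 h₀ x ∧ (thetaX2 h₀ x : ℝ) ≤ 3 * x := by
  obtain ⟨h1, h2, -, -, -, h6, -, -⟩ := thetaX_bounds h₀ hx
  have habs : ((h₀.natAbs : ℕ) : ℝ) = |(h₀ : ℝ)| := by rw [Nat.cast_natAbs, Int.cast_abs]
  have hh : (h₀ : ℝ) ≤ h₀.natAbs := by rw [habs]; exact le_abs_self _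
  exact ⟨h1, h2, by linarith⟩

/-! ### The truncated inner sequence -/

section Trunc

/-- The rough-number indicator `1_{p(n) > z}` (all prime factors exceed `z`). [cite: Polymath8b2014, §4.5, (lltrunc)] -/
def roughInd (z : ℝ) (n : ℕ) : ℝ := if ∀ p ∈ n.primeFactorsList, z < (p : ℝ) then 1 else 0

/-- The truncated inner sequence `w_ε(n) = λ_F(n) λ_G(n) 1_{p(n) > x^ε}`. [cite: Polymath8b2014, §4.5, (lltrunc)] -/
def wTrunc (F G : ℝ → ℝ) (ε x : ℝ) (n : ℕ) : ℝ :=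
  divisorSumWeight F x n * divisorSumWeight G x n * roughInd (x ^ ε) n

/-- The rough indicator is `1` on rough numbers. [folklore] -/
theorem roughInd_eq_one {z : ℝ} {n : ℕ} (h : ∀ p ∈ n.primeFactorsList, z < (p : ℝ)) : roughInd z n = 1 :=
  if_pos h

/-- The rough indicator is `0` otherwise. [folklore] -/
theorem roughInd_eq_zero {z : ℝ} {n : ℕ} (h : ¬ ∀ p ∈ n.primeFactorsList, z < (p : ℝ)) : roughInd z n = 0 :=
  if_neg h

/-- `w_ε(n) ≠ 0` forces `n` to be `x^ε`-rough. [folklore] -/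
theorem rough_of_wTrunc_ne_zero {F G : ℝ → ℝ} {ε x : ℝ} {n : ℕ} (h : wTrunc F G ε x n ≠ 0) :
    ∀ p ∈ n.primeFactorsList, x ^ ε < (p : ℝ) := by
  by_contra hno
  exact h (by rw [wTrunc, roughInd_eq_zero hno, mul_zero])

/-- **`|λ_F(n)| ≤ 2^{ω(n)} sup |F|`** (only square-free divisors contribute). [folklore] -/
theorem abs_divisorSumWeight_le_two_pow {F : ℝ → ℝ} {M : ℝ} (hM : ∀ t, |F t| ≤ M) (x : ℝ) {n : ℕ} (hn : n ≠ 0) :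
    |divisorSumWeight F x n| ≤ 2 ^ ω n * M := by
  unfold divisorSumWeight
  have hM0 : 0 ≤ M := (abs_nonneg _).trans (hM 0)
  refine (Finset.abs_sum_le_sum_abs _ _).trans ?_
  -- only square-free divisors count, at most `M` each
  calc ∑ d ∈ n.divisors, |(μ d : ℝ) * F (Real.log d / Real.log x)|
      ≤ ∑ d ∈ n.divisors, (if Squarefree d then M else 0) := by
        refine Finset.sum_le_sum fun d _ => ?_
        by_cases hsq : Squarefree d
        · rw [if_pos hsq, abs_mul]
          have hμ : |(μ d : ℝ)| ≤ 1 := by exact_mod_cast ArithmeticFunction.abs_moebius_le_one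
          calc |(μ d : ℝ)| * |F (Real.log d / Real.log x)| ≤ 1 * M :=
                mul_le_mul hμ (hM _) (abs_nonneg _) zero_le_one
            _ = M := one_mul M
        · rw [if_neg hsq, ArithmeticFunction.moebius_eq_zero_of_not_squarefree hsq]; simp
    _ = M * ((n.divisors.filter Squarefree).card : ℝ) := by
        rw [Finset.sum_ite, Finset.sum_const_zero, add_zero, Finset.sum_const, nsmul_eq_mul, mul_comm]
    _ ≤ M * 2 ^ ω n := by
        refine mul_le_mul_of_nonneg_left ?_ hM0
        have hcard : (n.divisors.filter Squarefree).card ≤ n.primeFactors.powerset.card := by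
          refine Finset.card_le_card_of_injOn Nat.primeFactors (fun d hd => ?_) (fun d hd d' hd' hdd' => ?_)
          · rw [Finset.coe_filter, Set.mem_setOf_eq, Nat.mem_divisors] at hd
            rw [Finset.mem_coe, Finset.mem_powerset]
            exact Nat.primeFactors_mono hd.1.1 hn
          · rw [Finset.coe_filter, Set.mem_setOf_eq] at hd hd'
            calc d = ∏ p ∈ d.primeFactors, p := (Nat.prod_primeFactors_of_squarefree hd.2).symm
              _ = ∏ p ∈ d'.primeFactors, p := by rw [hdd']
              _ = d' := Nat.prod_primeFactors_of_squarefree hd'.2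
        have hω : n.primeFactors.card = ω n := by
          rw [ArithmeticFunction.cardDistinctFactors_apply, Nat.primeFactors, List.card_toFinset]
        rw [Finset.card_powerset, hω] at hcard
        exact_mod_cast hcard
    _ = 2 ^ ω n * M := mul_comm _ _

end Trunc

end Literature.NumberTheory.Sieve
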